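import Mathlib
import HarnessLib
import Summits.FinalStateConjecture.FinalStateConjecture.Theses.ExactKerrEnds
import Literature.Geometry.Lorentzian.KerrData
import Literature.Geometry.Lorentzian.TameGenericityDiagonal
import Literature.Geometry.Lorentzian.ExactKerrEnd

/-!
# `ExactKerrEnds.SettlingAlongCensoredKerrEnds` (stmt-FinalStateConjecture-18520) ⇐ X₁ ∧ K ∧ U — the split,
# concluding the route decl BY NAME (crux-strategist line `kerr-ended-attraction`, 2026-08-17; landed by
# prover seat 2 as the `--supports` glue the strategist's STRATEGY-CENSUS §D1 asks for)

`settlingAlongCensoredKerrEnds_of_subs : X₁ → K → U → Theses.ExactKerrEnds.SettlingAlongCensoredKerrEnds`: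
X₁ = pointwise honest C⁰ settling (closed spin range) of censored MGHDs of Kerr-ended admissible data;
K = the relative, censorship-preserving third-law kick along censored Kerr-ended curves (existential C⁰ third
law; no settling conclusion); U = the pointwise redshift upgrade C⁰ → C² at sub-extremal final states for
Kerr-ended data.  Transfer of route GlobalAttraction's `closes` (C2/C3/C4) to the Kerr-ended class in the
relative form route ExactKerrEnds composes with; the same proof as
`Cruxes/SettlingAlongCensoredKerrEnds/Lines/kerr_ended_attraction.lean`, with the conclusion the route decl `Theses.ExactKerrEnds.SettlingAlongCensoredKerrEnds` BY NAME (the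
Theses-free δ-unfolded twin is the strategist's `Cruxes/SettlingAlongCensoredKerrEnds/KerrEndedAttractionSplit.lean`).  Sources: Komech2021 Ch. VI; arXiv:2402.10190 §1.4, Conjecture 5; DafermosRodnianskiShlapentokhrothman2014.
-/

noncomputable section

set_option linter.dupNamespace false

open Set Function Filter Topology TopologicalSpace
open scoped ENNReal Topology Manifold ContDiff
open Literature.Geometry.Lorentzian

namespace Summit.FinalStateConjecture.FinalStateConjecture.Theorems.ExactKerrEnds

/-- **`SettlingAlongCensoredKerrEnds` from the three pieces X₁ (C⁰ global attraction on the Kerr-ended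
class), K (relative third-law kick), U (Kerr-ended redshift upgrade).** Along a censored Kerr-ended curve
`F`, K hands back `F'`; for each member off `0` and each MGHD: censorship ⇒ complete 𝓘⁺, X₁ ⇒ an honest
C⁰ decomposition, the existential third law ⇒ one with sub-extremal holes, U ⇒ the honest sub-extremal
C² decomposition of the Statement's settling clause. [cite: Komech2021, Ch. VI] [cite: KehleUnger2024, §1.4] -/
theorem settlingAlongCensoredKerrEnds_of_subs :
    (∀ (X : Type) [TopologicalSpace X] [ChartedSpace E3 X] [IsManifold (𝓡 3) ∞ X] [T2Space X]
      [SecondCountableTopology X] [ConnectedSpace X],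
      ∀ D ∈ admissibleVacuumData X, D.HasExactKerrEnd →
        ∀ 𝒟 : VacuumCauchyDevelopment D, 𝒟.IsMaximal →
          Summit.FinalStateConjecture.HasCompleteNullInfinity 𝒟.toCauchyDevelopment →
            ∃ (O : Set 𝒟.carrier) (d : FinalStateDecomposition 𝒟.toSpacetime O 0),
              O = Summit.FinalStateConjecture.exteriorOf 𝒟.toCauchyDevelopment d.charted ∧
                Summit.FinalStateConjecture.RaysStayInClosure 𝒟.toCauchyDevelopment O ∧
                  Summit.FinalStateConjecture.HasExhaustiveCharts d ∧
                    Summit.FinalStateConjecture.IsFutureOriented d) →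
    (∀ (X : Type) [TopologicalSpace X] [ChartedSpace E3 X] [IsManifold (𝓡 3) ∞ X] [T2Space X]
      [SecondCountableTopology X] [ConnectedSpace X],
      ∀ (e : AFEnd X) (F : EuclideanSpace ℝ (Fin 1) → InitialDataSet (𝓡 3) X),
        InitialDataSet.IsTameDataFamily e 1 F →
          ((InitialDataSet.IsImmersedAtZero 1 F ∧ Injective F) ∨ ∀ c, F c = F 0) →
            (∀ c, F c ∈ admissibleVacuumData X) →
              (∀ c ≠ 0, (F c).HasExactKerrEnd ∧
                ∀ 𝒟 : VacuumCauchyDevelopment (F c), 𝒟.IsMaximal →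
                  Summit.FinalStateConjecture.HasCompleteNullInfinity 𝒟.toCauchyDevelopment) →
                ∃ (e' : AFEnd X) (F' : EuclideanSpace ℝ (Fin 1) → InitialDataSet (𝓡 3) X),
                  InitialDataSet.IsTameDataFamily e' 1 F' ∧ F' 0 = F 0 ∧ Injective F' ∧
                    InitialDataSet.IsImmersedAtZero 1 F' ∧
                    (∀ c, F' c ∈ admissibleVacuumData X) ∧
                    ∀ c ≠ 0, (F' c).HasExactKerrEnd ∧
                      (∀ 𝒟 : VacuumCauchyDevelopment (F' c), 𝒟.IsMaximal →
                        Summit.FinalStateConjecture.HasCompleteNullInfinity 𝒟.toCauchyDevelopment) ∧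
                      ∀ 𝒟 : VacuumCauchyDevelopment (F' c), 𝒟.IsMaximal →
                        (∃ (O : Set 𝒟.carrier) (d : FinalStateDecomposition 𝒟.toSpacetime O 0),
                          O = Summit.FinalStateConjecture.exteriorOf 𝒟.toCauchyDevelopment d.charted ∧
                            Summit.FinalStateConjecture.RaysStayInClosure 𝒟.toCauchyDevelopment O ∧
                              Summit.FinalStateConjecture.HasExhaustiveCharts d ∧
                                Summit.FinalStateConjecture.IsFutureOriented d) →
                          ∃ (O : Set 𝒟.carrier) (d : FinalStateDecomposition 𝒟.toSpacetime O 0),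
                            (∀ i, Kerr.IsSubextremal (d.mass i) (d.spin i)) ∧
                            O = Summit.FinalStateConjecture.exteriorOf 𝒟.toCauchyDevelopment d.charted ∧
                              Summit.FinalStateConjecture.RaysStayInClosure 𝒟.toCauchyDevelopment O ∧
                                Summit.FinalStateConjecture.HasExhaustiveCharts d ∧
                                  Summit.FinalStateConjecture.IsFutureOriented d) →
    (∀ (X : Type) [TopologicalSpace X] [ChartedSpace E3 X] [IsManifold (𝓡 3) ∞ X] [T2Space X]
      [SecondCountableTopology X] [ConnectedSpace X],
      ∀ D ∈ admissibleVacuumData X, D.HasExactKerrEnd →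
        ∀ 𝒟 : VacuumCauchyDevelopment D, 𝒟.IsMaximal →
          Summit.FinalStateConjecture.HasCompleteNullInfinity 𝒟.toCauchyDevelopment →
            ∀ (O : Set 𝒟.carrier) (d₀ : FinalStateDecomposition 𝒟.toSpacetime O 0),
              O = Summit.FinalStateConjecture.exteriorOf 𝒟.toCauchyDevelopment d₀.charted →
                Summit.FinalStateConjecture.RaysStayInClosure 𝒟.toCauchyDevelopment O →
                  Summit.FinalStateConjecture.HasExhaustiveCharts d₀ →
                    Summit.FinalStateConjecture.IsFutureOriented d₀ →
                      (∀ i, Kerr.IsSubextremal (d₀.mass i) (d₀.spin i)) →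
                        ∃ (O' : Set 𝒟.carrier) (d : FinalStateDecomposition 𝒟.toSpacetime O' 2),
                          (∀ i, Kerr.IsSubextremal (d.mass i) (d.spin i)) ∧
                            O' = Summit.FinalStateConjecture.exteriorOf 𝒟.toCauchyDevelopment d.charted ∧
                              Summit.FinalStateConjecture.RaysStayInClosure 𝒟.toCauchyDevelopment O' ∧
                                Summit.FinalStateConjecture.HasExhaustiveCharts d ∧
                                  Summit.FinalStateConjecture.IsFutureOriented d) →
    Summit.FinalStateConjecture.FinalStateConjecture.Theses.ExactKerrEnds.SettlingAlongCensoredKerrEnds := by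
  intro h₁ hK hU X _ _ _ _ _ _ KerrEnded Censored Settled e F hF hdich h𝓓 hQ
  -- the members off `0` of `F` are Kerr-ended (legend = `HasExactKerrEnd`, definitionally) and censored
  have hQ' : ∀ c ≠ 0, (F c).HasExactKerrEnd ∧
      ∀ 𝒟 : VacuumCauchyDevelopment (F c), 𝒟.IsMaximal →
        Summit.FinalStateConjecture.HasCompleteNullInfinity 𝒟.toCauchyDevelopment := fun c hc ↦
    ⟨(InitialDataSet.hasExactKerrEnd_iff (F c)).2 (hQ c hc).1, (hQ c hc).2⟩
  -- the kick: a tame injective immersed admissible curve through `F 0` of Kerr-ended, censored,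
  -- third-law data
  obtain ⟨e', F', hF', hF'0, hinj, himm, h𝓓', hP⟩ := hK X e F hF hdich h𝓓 hQ'
  refine ⟨e', F', hF', hF'0, hinj, himm, h𝓓', fun c hc 𝒟 hmax ↦ ?_⟩
  obtain ⟨hKE, hCen, hTL⟩ := hP c hc
  -- complete 𝓘⁺ from censorship
  have hscri : Summit.FinalStateConjecture.HasCompleteNullInfinity 𝒟.toCauchyDevelopment := hCen 𝒟 hmax
  refine ⟨hscri, ?_⟩
  -- an honest C⁰ decomposition from X₁, a sub-extremal one from the third law, the C² one from U
  obtain ⟨O₀, d₀, hO₀, hR₀, hE₀, hFO₀⟩ := h₁ X (F' c) (h𝓓' c) hKE 𝒟 hmax hscri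
  obtain ⟨O, d₁, hsub₁, hO, hR, hE, hFO⟩ := hTL 𝒟 hmax ⟨O₀, d₀, hO₀, hR₀, hE₀, hFO₀⟩
  obtain ⟨O', d, hsub, hO', hR', hE', hFO'⟩ :=
    hU X (F' c) (h𝓓' c) hKE 𝒟 hmax hscri O d₁ hO hR hE hFO hsub₁
  exact ⟨O', d, hsub, hO', hR', hE', hFO'⟩

end Summit.FinalStateConjecture.FinalStateConjecture.Theorems.ExactKerrEnds

end
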